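import Summits.Langlands.Langlands.Theses.HeptagonalTower

/-!
# Route HeptagonalTower — the `Assembly` item (stmt-Langlands-16843)

`Assembly := NonvanishingSevenTwists → KatoRankZeroSeven → OddDegreeDoor → TorsionSeven →
SectorComplement → Langlands` is pure logic: from the non-vanishing certificate and Kato's step every
`K`-point of `X₀(15)` over a layer `K` of the real 7-cyclotomic tower is torsion, by `TorsionSeven`
every torsion point is one of the eight rational ones, so `OddDegreeDoor` yields `Target` (every
elliptic curve over `K` is modular), and `SectorComplement : Target → Langlands` finishes.
No mathematics beyond modus ponens is used; axioms are the standard three.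
-/

set_option linter.dupNamespace false -- project-wide option (lakefile weak.linter.dupNamespace); `Summit.Langlands.Langlands` is the mandated namespace

namespace Summit.Langlands.Langlands.Theorems

open Summit.Langlands.Langlands.Theses.HeptagonalTower

/-- **The four cruxes give `Target`.** For every totally real `K` embedding in some `ℚ(ζ_{7^{n+1}})`:
`KatoRankZeroSeven` (fed by `NonvanishingSevenTwists`) makes every `K`-point of the Legendre model of
`X₀(15)` torsion, `TorsionSeven` identifies the torsion points with the eight rational ones, and
`OddDegreeDoor` turns these two facts into modularity of every elliptic curve over `K`. -/
theorem heptagonalTower_target_of_cruxes (hNV : NonvanishingSevenTwists) (hK : KatoRankZeroSeven)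
    (hD : OddDegreeDoor) (hT : TorsionSeven) : Target := by
  intro K _ _ hK' hemb E hE
  exact hD K hK' hemb (hK hNV K hK' hemb) (hT K hK' hemb) E hE

/-- **`Assembly` (stmt-Langlands-16843) holds**: it is modus ponens — `SectorComplement` applied to
the `Target` assembled from the four cruxes by `heptagonalTower_target_of_cruxes`. -/
theorem heptagonalTower_assembly_proof :
    Summit.Langlands.Langlands.Theses.HeptagonalTower.Assembly := by
  unfold Summit.Langlands.Langlands.Theses.HeptagonalTower.Assembly
  intro hNV hK hD hT hC
  exact hC (heptagonalTower_target_of_cruxes hNV hK hD hT)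

end Summit.Langlands.Langlands.Theorems
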